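import Summits.BirchSwinnertonDyer.Rank1Residual.X11b.Three.RouteR1Lower
import HarnessLib

/-!
# X11b at `p = 3`, route R1: the display (5.3) SPLIT into its two halves as NAMED binders — (A≥|VoR) = STEP L in erratum-field currency, (A≤|VoR) the Euler-system side (cell `b2b-bsdres`, team `x11b3`, seat p6; lead deal #3 (i) / LINE-W.md §C LW-B1)

HONEST FRAMING (cell `b2b-bsdres`, run/shared/lean/b2b/bsd-rank1-residual/, verbatim in every
file): the goal of the cell is to DELETE the COMBINATION-SHAPED residual classes of the
Birch–Swinnerton-Dyer formula for ALL analytic-rank `≤ 1` elliptic curves over `ℚ` — "full BSD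
formula for every rank `≤ 1` curve in class `C`" assembled STRICTLY from published theorems — so
that the rank-`≤ 1` remainder becomes exactly the CONSTRUCTION-SHAPED classes, which are TYPED
(missing-input `Prop`s), NOT attempted. This is not "finishing BSD". Team `x11b3` (N8/O2: X11b at
`p = 3`); a RESEARCH ROUTE; no claim beyond the stated class and sub-populations; X11 ∧ `r = 1` at
`p = 3` stays CONSTRUCTION-SHAPED / O2 OPEN; nothing here books anything or changes a label. Two
`Prop`-valued PREDICATES (per-pair SHAPES with explicit binders; nothing asserted; NOT named facts)
and theorems; no `sorry`. Companion to `Three/RouteR1Lower.lean` (which states the `≥`-half inline);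
`Three/RouteR1Descent.lean` is not mutated (lead deal #3 (i)).

## What this file does

multr1-p1's `Display53At W p K P` (`X11b/CastellaErratum.lean`) is Castella's display (5.3) at
`(E, p, K, P)` as an EQUALITY: `ord_p #Ш(E/K)[p^∞] = 2·ord_p[E(K):ℤP] − ord_p ∏_w c_w(E/K)`. The
team's LINE W (planner r1, `cells/x11b3/LINE-W.md` §B) is an architecture for ONE direction only.
This file NAMES the two halves so that the team's documents, route R1's `p = 3` end forms and LINE W
cite one declaration each:

* `Display53LowerAt W p K P` — (A≥): `2·ord_p[E(K):ℤP] − ord_p ∏_w c_w(E/K) ≤ ord_p #Ш(E/K)[p^∞]`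
  = STEP L in erratum-field currency (the IMC / main-conjecture direction; LINE W≥'s target:
  MI-W3 ∘ W2 ∘ S3 at `p = 3`, OPEN);
* `Display53UpperAt W p K P` — (A≤): the reverse inequality (the Euler-system / Kolyvagin direction);
* `R1.display53At_iff_lower_and_upper` — `Display53At ↔ Lower ∧ Upper` (definitional split);
* `display53LowerAt_iff_indexLowerBoundAt` — on an erratum field at an odd `q`, odd `p` with
  `p ∤ v_q(Δ_min)`, and `Ш(E/K)` finite: `Display53LowerAt W p K P ↔ IndexLowerBoundAt W p K P` — the
  `≥`-half IS the route-p2 / S0 predicate STEP L (`2·ord_p[E(K):ℤP] ≤ ord_p #Ш(E/K) + 2·ord_p ∏_ℓ c_ℓ(E)`,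
  JSW17 (eq:shalowerK-1)) read at the erratum field, because there `ord_p ∏_w c_w(E/K) =
  2·ord_p ∏_ℓ c_ℓ(E)` (link (C) at odd `p`, `tamagawaDescentAt_of_isErratumField_odd`, with
  `ord_p ∏c(E^{(d_K)}) = ord_p ∏c(E)`, `padicValNat_tamagawaProduct_twist_eq_of_isErratumField_odd`);
* the `p = 3` end forms of `Three/RouteR1Lower.lean` restated with the named binder:
  `R1.missingLowerBoundAt_three_of_display53LowerAt` (main-conjecture half of `BSD(E,3)` on R1's
  population ⇐ 7 PUB facts + (A≥|VoR)@3) and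
  `R1.bsdp_three_of_display53LowerAt_of_not_dvd_tamagawaProduct` (`BSD(E,3)` on R1's population ∩
  {`3 ∤ ∏c`} ⇐ PUB facts of both sub-cells + (A≥|VoR)@3).

Status of the binders at `p = 3` (hypothesis police, `cells/x11b3/REFEREE.md` §2): (A≥|VoR)@3 and
(A|VoR)@3 are NOT cited facts; NO source and NO announcement at `3`; nothing here asserts them.

References: [Castella2018] §5, (5.3) (arXiv:1704.06608 p. 12); [JetchevSkinnerWan2017] §7.4.1
(eq:shalowerK-1) (arXiv:1512.06894 p. 30); [Castella2018Erratum] Thm. 1.1, Thm. A′ (p. 1);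
cells/x11b3/LINE-W.md §B–§C (r1); cells/x11b3/OWNERS.md deal #3.
-/

noncomputable section

open scoped Classical

open WeierstrassCurve NumberField Literature.NumberTheory.EllipticCurves
  Literature.NumberTheory.EllipticCurves.ModularForms
  Literature.NumberTheory.EllipticCurves.Rank1Residual
  Literature.NumberTheory.EllipticCurves.Rank1Residual.Typed
  Literature.NumberTheory.EllipticCurves.Wuthrich2014

namespace Summit.BirchSwinnertonDyer.Rank1Residual.X11b.Three

/-! ### The two halves of Castella's display (5.3), named -/

section Defs

variable (W : WeierstrassCurve ℚ) (p : ℕ) (K : Type) [Field K] [NumberField K]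

/-- **(A≥) — the `≥`-half of Castella's display (5.3) at `(E, p, K, P)`** — STEP L in
erratum-field currency: `2·ord_p[E(K):ℤP] − ord_p ∏_w c_w(E/K) ≤ ord_p #Ш(E/K)[p^∞]` (arXiv:1704.06608
p. 12, the direction delivered by "`Ch_Λ(X_ac) ⊆ (L_p(f))`" ∘ control ∘ Waldspurger; JSW17 §7.4.1
(eq:shalowerK-1) over the field `K`). The IMC / main-conjecture direction; at `p = 3` it is the target
of the team's LINE W≥ (`cells/x11b3/LINE-W.md` §B: Hida at `3`, congruences, MI-W3 [unrefereed],
W2 [construction missing in print], S3). A per-pair SHAPE (predicate with explicit binders, stated on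
the `p`-primary part so that no finiteness of `Ш(E/K)` is presupposed); NOT a cited fact; nothing
asserted; OPEN at `p = 3`. [cite: Castella2018, §5 eq. (5.3) (arXiv:1704.06608 p. 12) (shape only; nothing asserted)]
[cite: JetchevSkinnerWan2017, §7.4.1 (eq:shalowerK-1) (arXiv:1512.06894 p. 30) (shape only; nothing asserted)] -/
def Display53LowerAt (P : (W.baseChange K).toAffine.Point) : Prop :=
  2 * (padicValNat p (AddSubgroup.zmultiples P).index : ℤ) -
      padicValNat p (W.baseChange K).tamagawaProduct ≤
    (padicValNat p (Nat.card (AddCommGroup.primaryComponent (W.baseChange K).sha p)) : ℤ)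

/-- **(A≤) — the `≤`-half of Castella's display (5.3) at `(E, p, K, P)`**:
`ord_p #Ш(E/K)[p^∞] ≤ 2·ord_p[E(K):ℤP] − ord_p ∏_w c_w(E/K)` — the Euler-system / Kolyvagin
direction ("`Ch_Λ(X_ac) ⊇ (L_p(f))`" ∘ control ∘ Waldspurger, erratum (2.3)). A per-pair SHAPE;
NOT a cited fact; nothing asserted. [cite: Castella2018, §5 eq. (5.3) (arXiv:1704.06608 p. 12) (shape only; nothing asserted)]
[cite: Castella2018Erratum, (2.3) (p. 3) (shape only; nothing asserted)] -/
def Display53UpperAt (P : (W.baseChange K).toAffine.Point) : Prop :=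
  (padicValNat p (Nat.card (AddCommGroup.primaryComponent (W.baseChange K).sha p)) : ℤ) ≤
    2 * (padicValNat p (AddSubgroup.zmultiples P).index : ℤ) -
      padicValNat p (W.baseChange K).tamagawaProduct

end Defs

/-! ### The split, and the `≥`-half as STEP L -/

section Split

variable (W : WeierstrassCurve ℚ) [W.IsElliptic] [W.IsGloballyMinimal] (p : ℕ) [Fact p.Prime]
  (K : Type) [Field K] [NumberField K]

omit [W.IsElliptic] [W.IsGloballyMinimal] [Fact p.Prime] in
/-- **`Display53At ↔ Display53LowerAt ∧ Display53UpperAt`** (the equality (5.3) is its two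
inequalities; lead deal #3 (i)). [folklore] -/
theorem R1.display53At_iff_lower_and_upper (P : (W.baseChange K).toAffine.Point) :
    Display53At W p K P ↔ Display53LowerAt W p K P ∧ Display53UpperAt W p K P := by
  unfold Display53At Display53LowerAt Display53UpperAt
  omega

omit [W.IsElliptic] [W.IsGloballyMinimal] [Fact p.Prime] in
/-- The inline `≥`-half used by `Three/RouteR1Lower.lean` is `Display53LowerAt` (`Iff.rfl`).
[folklore] -/
theorem display53LowerAt_iff (P : (W.baseChange K).toAffine.Point) :
    Display53LowerAt W p K P ↔
      2 * (padicValNat p (AddSubgroup.zmultiples P).index : ℤ) -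
          padicValNat p (W.baseChange K).tamagawaProduct ≤
        (padicValNat p (Nat.card (AddCommGroup.primaryComponent (W.baseChange K).sha p)) : ℤ) :=
  Iff.rfl

/-- **On an erratum field the `≥`-half IS STEP L** (`IndexLowerBoundAt W p K P`:
`2·ord_p[E(K):ℤP] ≤ ord_p #Ш(E/K) + 2·ord_p ∏_ℓ c_ℓ(E)`, JSW17 (eq:shalowerK-1), the predicate of
route p2 / team item S0 read at the field `K`): for `W/ℚ` globally minimal, `p` odd, `q` an odd
multiplicative prime with `p ∤ v_q(Δ_min)`, `K` an erratum field for `q`, `Ш(E/K)` finite (so that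
`ord_p #Ш(E/K)[p^∞] = ord_p #Ш(E/K)`), and `P ∈ E(K)`:
`Display53LowerAt W p K P ↔ IndexLowerBoundAt W p K P`, because `ord_p ∏_w c_w(E/K) =
ord_p ∏c(E) + ord_p ∏c(E^{(d_K)}) = 2·ord_p ∏c(E)` (link (C) at odd `p`,
`tamagawaDescentAt_of_isErratumField_odd`, and `padicValNat_tamagawaProduct_twist_eq_of_isErratumField_odd`).
[cite: JetchevSkinnerWan2017, §7.4.1 (eq:shalowerK-1) and §7.3.1 (eq:tamK) (arXiv:1512.06894 p. 30)]
[cite: Castella2018, §5 (arXiv:1704.06608 p. 12), Tamagawa relation] -/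
theorem display53LowerAt_iff_indexLowerBoundAt (hp2 : p ≠ 2) {q : ℕ} [Fact q.Prime] (hq2 : q ≠ 2)
    (hmq : Mult W q) (hvq : ¬ p ∣ padicValInt q W.minimalDiscriminantInt) (hK : IsErratumField W K q)
    [Finite (W.baseChange K).sha] (P : (W.baseChange K).toAffine.Point) :
    Display53LowerAt W p K P ↔ IndexLowerBoundAt W p K P := by
  have hd0 : (NumberField.discr K : ℚ) ≠ 0 := by exact_mod_cast NumberField.discr_ne_zero K
  haveI := W.isElliptic_quadraticTwist hd0
  have hWd : ∃ C : VariableChange ℚ, C • W.quadraticTwist (NumberField.discr K : ℚ) =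
      W.quadraticTwist (NumberField.discr K : ℚ) := ⟨1, one_smul _ _⟩
  have hC := tamagawaDescentAt_of_isErratumField_odd W p hp2 q hq2 hmq hvq K hK
    (W.quadraticTwist (NumberField.discr K : ℚ)) hWd
  have hT := padicValNat_tamagawaProduct_twist_eq_of_isErratumField_odd W p hp2 q hq2 hmq hvq K hK
    (W.quadraticTwist (NumberField.discr K : ℚ)) hWd
  unfold TamagawaDescentAt at hC
  haveI : (W.baseChange K).IsElliptic := by rw [WeierstrassCurve.baseChange]; infer_instance
  have hSha : padicValNat p (Nat.card (AddCommGroup.primaryComponent (W.baseChange K).sha p)) =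
      padicValNat p (W.baseChange K).shaOrder := by
    rw [padicValNat_card_addPrimaryComponent]; rfl
  unfold Display53LowerAt IndexLowerBoundAt
  rw [hSha, hC, hT]
  omega

end Split

/-! ### Route R1's `p = 3` end forms from the named `≥`-half -/

section Three

/-- **The main-conjecture half of `BSD(E,3)` on route R1's population from (A≥|VoR)@3, named** —
`R1.missingLowerBoundAt_three_of_displayLower` of `Three/RouteR1Lower.lean` with its inline binder
replaced by `Display53LowerAt W 3 K P`: for `W/ℚ` globally minimal with `IsX11Three W` on the
A′ ∧ (ram2)-locus at `3`, an odd non-split multiplicative `q ≠ 3` with `3 ∤ v_q(Δ_min)` and an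
erratum field `K` for `q`, `Typed.MissingLowerBoundAt W 3` from SEVEN published named facts (`hGZ`
GZ86 I.7.3, `hGZK`, `hSk` Skinner 2016 Thm. C, `hmod`, `hCST` CST14 Thm. 1.1, `hMaz`, `hNS`) and the
ONE OPEN binder `hA` = (A≥|VoR)@3: `Display53LowerAt W 3 K P` at every Manin-good Heegner datum over
erratum fields meeting [Cas20, §2.5] (NOT a cited fact; no source, no announcement at `3`; LINE W≥).
CONDITIONAL on `hA`; deletes nothing; X11 ∧ `r = 1` at `3` stays CONSTRUCTION-SHAPED.
[cite: Castella2018, §5 (arXiv:1704.06608 p. 12)] [cite: JetchevSkinnerWan2017, §7.4.1 (eq:shalowerK-1)]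
[cite: Castella2018Erratum, Thm. A′ (p. 1) with "p > 3" read as "p = 3" (shape only; nothing asserted)] -/
theorem R1.missingLowerBoundAt_three_of_display53LowerAt
    (hGZ : GrossZagier1986_thm_I_7_3) (hGZK : rank_eq_analyticRank_of_analyticRank_le_one)
    (hSk : Skinner2016.thmC_padicValRat_bsd_rank_zero) (hmod : exists_isNewformOf)
    (hCST : CaiShuTian2014.thm11_trivialChar)
    (hMaz : mazur_not_dvd_maninConstant_of_odd) (hNS : integral_neronScaling_of_isGloballyMinimal)
    (hA : ∀ (W : WeierstrassCurve ℚ) [W.IsElliptic] [W.IsGloballyMinimal] [NeZero (W.conductorNorm ℤ)]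
        (q : ℕ) [Fact q.Prime] (K : Type) [Field K] [NumberField K]
        (Dt : ModularParametrizationData W (W.conductorNorm ℤ))
        (H : HeegnerDatum (W.conductorNorm ℤ) (NumberField.discr K)) (ι : K →+* ℂ)
        (P : (W.baseChange K).toAffine.Point),
        IsX11Three W → X11.AprimeLocusAt W 3 → q ≠ 3 → Mult W q →
        ¬ W.HasSplitMultiplicativeReductionAtPrime q → ¬ 3 ∣ padicValInt q W.minimalDiscriminantInt →
        IsErratumField W K q → Cas20Standing K 3 (W.conductorNorm ℤ / 3) →
        WeierstrassCurve.Affine.Point.map ι.toRatAlgHom P = heegnerPointComplex Dt H →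
        ¬ (3 : ℤ) ∣ Dt.c → ¬ IsOfFinAddOrder P → Display53LowerAt W 3 K P)
    (W : WeierstrassCurve ℚ) [W.IsElliptic] [W.IsGloballyMinimal]
    (hX : IsX11Three W) (hloc : X11.AprimeRam2LocusAt W 3)
    (q : ℕ) [Fact q.Prime] (hq2 : q ≠ 2) (hq3 : q ≠ 3) (hmq : Mult W q)
    (hnsq : ¬ W.HasSplitMultiplicativeReductionAtPrime q)
    (hvq : ¬ 3 ∣ padicValInt q W.minimalDiscriminantInt)
    (K : Type) [Field K] [NumberField K] (hKf : IsErratumField W K q) :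
    Typed.MissingLowerBoundAt W 3 :=
  R1.missingLowerBoundAt_three_of_displayLower hGZ hGZK hSk hmod hCST hMaz hNS
    (fun W _ _ _ q _ K _ _ Dt H ι P hX hl hq3 hmq hns hv hK hS hP hc hnt ↦
      (display53LowerAt_iff W 3 K P).mp (hA W q K Dt H ι P hX hl hq3 hmq hns hv hK hS hP hc hnt))
    W hX hloc q hq2 hq3 hmq hnsq hvq K hKf

/-- **`BSD(E,3)` on route R1's population ∩ {`3 ∤ ∏_ℓ c_ℓ(E)`} from (A≥|VoR)@3, named** —
`R1.bsdp_three_of_displayLower_of_not_dvd_tamagawaProduct` of `Three/RouteR1Lower.lean` with its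
inline binder replaced by `Display53LowerAt W 3 K P`: the UPPER half is multr1-p2's Kolyvagin theorem
(`IsX11Three.missingUpperBoundAt_of_ram_of_not_dvd`, published facts `hGZ hKo hB hSk hGZK hmod hnf hHL
hMaz hNS`), the LOWER half the named `≥`-binder through route R1 (`hGZ1 hCST hFH` + the above), so on
R1's population ∩ A1 the kernel asks of the literature EXACTLY the `≥`-direction LINE W≥ is designed to
supply. CONDITIONAL on `hA`; deletes nothing; X11 ∧ `r = 1` at `3` stays CONSTRUCTION-SHAPED; no
label change. [cite: McCallumLMS1991, §1 Theorem (Kolyvagin), p. 296]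
[cite: Castella2018, §5 (arXiv:1704.06608 p. 12)] [cite: JetchevSkinnerWan2017, §7.4.1 (eq:shalowerK-1)]
[cite: Miller2011LMS, Def. 1.1] -/
theorem R1.bsdp_three_of_display53LowerAt_of_not_dvd_tamagawaProduct
    (hGZ : ∀ (N : ℕ) [NeZero N] (W : WeierstrassCurve ℚ) (K : Type) [Field K] [NumberField K],
      gross_zagier N W K)
    (hKo : ∀ (N : ℕ) [NeZero N] (W : WeierstrassCurve ℚ) (K : Type) [Field K] [NumberField K],
      kolyvagin N W K)
    (hB : ∀ (N : ℕ) [NeZero N] (W : WeierstrassCurve ℚ) (K : Type) [Field K] [NumberField K],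
      Kolyvagin1990_padicValNat_card_sha_le N W K)
    (hSk : Skinner2016.thmC_padicValRat_bsd_rank_zero)
    (hGZK : rank_eq_analyticRank_of_analyticRank_le_one) (hmod : hasEntireLFunction_rat)
    (hnf : exists_isNewformOf) (hHL : HoffsteinLuo1997_exists_twist_L_one_ne_zero)
    (hMaz : mazur_not_dvd_maninConstant_of_odd) (hNS : integral_neronScaling_of_isGloballyMinimal)
    (hGZ1 : GrossZagier1986_thm_I_7_3) (hCST : CaiShuTian2014.thm11_trivialChar)
    (hFH : friedbergHoffstein_exists_twist_ne_zero_ramifiedAt)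
    (hA : ∀ (W : WeierstrassCurve ℚ) [W.IsElliptic] [W.IsGloballyMinimal] [NeZero (W.conductorNorm ℤ)]
        (q : ℕ) [Fact q.Prime] (K : Type) [Field K] [NumberField K]
        (Dt : ModularParametrizationData W (W.conductorNorm ℤ))
        (H : HeegnerDatum (W.conductorNorm ℤ) (NumberField.discr K)) (ι : K →+* ℂ)
        (P : (W.baseChange K).toAffine.Point),
        IsX11Three W → X11.AprimeLocusAt W 3 → q ≠ 3 → Mult W q →
        ¬ W.HasSplitMultiplicativeReductionAtPrime q → ¬ 3 ∣ padicValInt q W.minimalDiscriminantInt →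
        IsErratumField W K q → Cas20Standing K 3 (W.conductorNorm ℤ / 3) →
        WeierstrassCurve.Affine.Point.map ι.toRatAlgHom P = heegnerPointComplex Dt H →
        ¬ (3 : ℤ) ∣ Dt.c → ¬ IsOfFinAddOrder P → Display53LowerAt W 3 K P)
    (W : WeierstrassCurve ℚ) [W.IsElliptic] [W.IsGloballyMinimal]
    (hX : IsX11Three W) (hloc : X11.AprimeRam2LocusAt W 3)
    (hq : ∃ (q : ℕ) (_ : Fact q.Prime), q ≠ 2 ∧ q ≠ 3 ∧ Mult W q ∧
      ¬ W.HasSplitMultiplicativeReductionAtPrime q ∧ ¬ 3 ∣ padicValInt q W.minimalDiscriminantInt)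
    (htam : ¬ 3 ∣ W.tamagawaProduct) : BSDp W 3 :=
  R1.bsdp_three_of_displayLower_of_not_dvd_tamagawaProduct hGZ hKo hB hSk hGZK hmod hnf hHL hMaz hNS
    hGZ1 hCST hFH
    (fun W _ _ _ q _ K _ _ Dt H ι P hX hl hq3 hmq hns hv hK hS hP hc hnt ↦
      (display53LowerAt_iff W 3 K P).mp (hA W q K Dt H ι P hX hl hq3 hmq hns hv hK hS hP hc hnt))
    W hX hloc hq htam

end Three

end Summit.BirchSwinnertonDyer.Rank1Residual.X11b.Three

end
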